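import Summits.HubbardSuperconductivity.HubbardSuperconductivity.Theorems.WidthHaldaneTubeHoppingSplit
import Literature.MathematicalPhysics.QuantumLattice.FreeFermionGraphSectorFloor
import Literature.MathematicalPhysics.QuantumLattice.HubbardAtomicLimit

/-!
# The kinetic floor on the energy window of the Hubbard tube, reduced to free Fermi sums

Support file for the tube cruxes stated over `WidthHaldaneDefs` (routes `WidthHaldane`,
`SeamInduction`; items stmt-HubbardSuperconductivity-16311/16312/18509/18510), all PROVED, no
definitions, no named facts. The Landau-form reduction of the stiffness floor (idea card
`landau-window-yrast` of crux stmt-16312; `WidthHaldaneTubeLandauCriterion.stiffnessOfLandauCriterion`,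
`WidthHaldaneTubeLandauLocalisation.tubeStiffness_ge_of_landauWindow`) takes two inputs on the unit
vectors `ψ` of the untwisted sector `(N, S^z = 0)` in the window `Re⟨ψ,H₀ψ⟩ - E(0) ≤ wM/L`: a KINETIC
FLOOR `K(ψ) ≥ k' LM` and a Landau criterion. The card asserts the first is provable ("`0 ≤ γ_ψ ≤ 1`
+ a free-fermion LP"); here it is PROVED in reduced form, with `K` the column kinetic form of
`WidthHaldaneKineticFloor` / `WidthHaldaneTubeLandauForm`, `L, M ≥ 3`, `U ≥ 0`, `N = 2n`:

* `transFermiSum_mul_normSq_le` — TRANSVERSE BATHTUB: `Re⟨ψ, T_⊥ ψ⟩ ≥ 2Σ_{F_⊥} ε_⊥ · ‖ψ‖²` for every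
  Fermi set `F_⊥` of `n` momenta of the transverse band `ε_⊥(a,b) = -2cos(2πb/M)` (Pauli principle:
  `fermiSum_mul_normSq_le_re_rayleigh_hamiltonian` on the transverse bond graph, plane-wave basis of
  `WidthHaldaneTubeHoppingSplit`);
* `re_expect_doublon_le` — `⟨Σ n↑n↓⟩ ≤ N↓ ‖ψ‖²` on Lieb's sector; `tubeEnergy_zero_le_free_add` —
  `E(U; 0, 2n) ≤ E(0; 0, 2n) + U n`;
* **`longKinetic_ge_of_window`** — for every unit window vector,
  `K(ψ) ≥ 2Σ_{F_⊥} ε_⊥ - E(0; 0, 2n) - U n - wM/L`; **`longKinetic_ge_of_window_free`** — with the free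
  floor written out (`tubeEnergy_free_eq`): `K(ψ) ≥ 2(Σ_{F_⊥} ε_⊥ - Σ_F ε_{L,M}) - U n - wM/L`.

So `KineticFloorAt` holds at every size with the explicit constant `k'LM = 2(Σ_{F_⊥}ε_⊥ - Σ_F ε_{L,M}) - Un - wM/L`
— a FREE-FERMION number (`≈ (1.52 - 1.21) LM = 0.31 LM` at `δ = 0.2`, against the true `k_x ≈ 0.76`)
minus `Un + wM/L`; its width-uniform asymptotics is a Riemann-sum estimate left to a certificate. What
remains of the card is its ★ stub, the Landau criterion on the window.

References: Scalapino–White–Zhang, PRB 47 (1993) 7995, §II; Lieb–Loss, *Analysis* (2001) Thm 1.14;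
E. H. Lieb, PRL 62 (1989) 1201 (sectors); idea card `landau-window-yrast` (crux 16312).
-/

noncomputable section

namespace Summit.HubbardSuperconductivity.HubbardSuperconductivity.Theorems.WidthHaldane

set_option linter.dupNamespace false -- summit = problem name (single-conjunct summit), D-0017

open scoped BigOperators Classical Matrix ComplexConjugate
open Matrix Literature.MathematicalPhysics.QuantumLattice
open Summit.HubbardSuperconductivity.HubbardSuperconductivity.Theorems.DeformationLadder
  (expect_hamiltonian_eq)

section TransverseBathtub

variable (L M : ℕ) [NeZero L] [NeZero M] (Λ : Type) [LinearOrder Λ] [Fintype Λ]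
  (e : Λ ≃ ZMod L × ZMod M)

open Literature.MathematicalPhysics.QuantumLattice.RayleighBound (normSq star_dotProduct_self_eq_normSq)

/-- **THE TRANSVERSE BATHTUB** (`M ≥ 3`): for every vector `ψ` of the sector `(2n, S^z = 0)` and
every Fermi set `F` of the transverse band `-2cos(2πb/M)` on `ℤ/L × ℤ/M` with `n` momenta
(`ε_⊥ ≤ μ` on `F`, `≥ μ` off `F`), `2Σ_{k∈F} ε_⊥(k) · ‖ψ‖² ≤ Re⟨ψ, T_⊥ ψ⟩`: the transverse hopping
energy of any state is at least that of the species-wise transverse Fermi seas (Pauli principle;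
`fermiSum_mul_normSq_le_re_rayleigh_hamiltonian` of `Literature/FreeFermionGraphSectorFloor` on the
transverse bond graph with the plane-wave eigenbasis). [folklore] -/
theorem transFermiSum_mul_normSq_le (hM : 3 ≤ M) (F : Finset (ZMod L × ZMod M)) (μ : ℝ)
    (hF : ∀ k ∈ F, -2 * Real.cos (2 * Real.pi * (k.2.val : ℝ) / M) ≤ μ)
    (hF' : ∀ k ∉ F, μ ≤ -2 * Real.cos (2 * Real.pi * (k.2.val : ℝ) / M))
    {ψ : Fock (Orb Λ)} (hψ : ψ ∈ szSector (2 * F.card) 0) :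
    (2 * ∑ k ∈ F, -2 * Real.cos (2 * Real.pi * (k.2.val : ℝ) / M)) * normSq ψ ≤
      (expect (hamiltonian (SimpleGraph.fromRel fun x y : Λ => y = e.symm ((e x).1, (e x).2 + 1)) 1 0) ψ).re := by
  rw [szSector_two_mul_zero_eq, mem_szSector_iff_isInSector] at hψ
  have h := fermiSum_mul_normSq_le_re_rayleigh_hamiltonian (SimpleGraph.fromRel fun x y : Λ => y = e.symm ((e x).1, (e x).2 + 1))
    (HubbardBandBottom.hubbardOneBody_orb_orb (SimpleGraph.fromRel fun x y : Λ => y = e.symm ((e x).1, (e x).2 + 1)))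
    (fun (k : ZMod L × ZMod M) (x : Λ) => (((Real.sqrt ((L : ℝ) * M))⁻¹ : ℝ) : ℂ) * tubeChar L M k (e x))
    (fun k => -2 * Real.cos (2 * Real.pi * (k.2.val : ℝ) / M))
    (planeWave_complete L M Λ e) (planeWave_orthonormal L M Λ e)
    (transAdj_mulVec_planeWave L M Λ e hM) F F μ μ hF hF' hF hF' le_rfl hψ
  rw [two_mul]
  exact h

/-- **Doublons are fewer than down electrons**: on Lieb's sector `(a, b)`,
`Re⟨ψ, Σ_x n_{x↑}n_{x↓} ψ⟩ ≤ b ‖ψ‖²` (`Σ_x n_{x↑}n_{x↓}` is diagonal with eigenvalue the number of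
doubly occupied sites, a subset of the down-occupied ones). [folklore] -/
theorem re_expect_doublon_le {a b : ℕ} {ψ : Fock (Orb Λ)} (hψ : IsInSector a b ψ) :
    (expect (∑ x : Λ, numberOp x 0 * numberOp x 1) ψ).re ≤ b * normSq ψ := by
  rw [expect, sum_numberOp_mul_numberOp_eq_diagonal, dotProduct, Complex.re_sum, normSq, Finset.mul_sum]
  refine Finset.sum_le_sum fun s _ => ?_
  rw [mulVec_diagonal, Pi.star_apply, Complex.star_def]
  by_cases hs : (upPart s).card = a ∧ (downPart s).card = b
  · have hcard : ((doublyOccupied s).card : ℝ) ≤ b := by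
      rw [← hs.2]
      exact_mod_cast Finset.card_le_card (Finset.inter_subset_right)
    have hre : (conj (ψ s) * (((doublyOccupied s).card : ℂ) * ψ s)).re =
        (doublyOccupied s).card * ‖ψ s‖ ^ 2 := by
      have h1 : conj (ψ s) * (((doublyOccupied s).card : ℂ) * ψ s) =
          ((((doublyOccupied s).card : ℝ) * ‖ψ s‖ ^ 2 : ℝ) : ℂ) := by
        rw [mul_left_comm, ← Complex.normSq_eq_conj_mul_self, Complex.normSq_eq_norm_sq]
        push_cast
        ring
      rw [h1, Complex.ofReal_re]
    rw [hre]
    exact mul_le_mul_of_nonneg_right hcard (by positivity)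
  · rw [hψ s hs]
    simp

end TransverseBathtub

section KineticWindow

variable (L M : ℕ) [NeZero L] [NeZero M] (Λ : Type) [LinearOrder Λ] [Fintype Λ]
  (e : Λ ≃ ZMod L × ZMod M)

open Literature.MathematicalPhysics.QuantumLattice.RayleighBound (normSq star_dotProduct_self_eq_normSq)

omit [NeZero L] [NeZero M] [LinearOrder Λ] in
/-- A unit vector has `normSq = 1`. [folklore] -/
theorem normSq_eq_one_of_unit {ψ : Fock (Orb Λ)} (h1 : star ψ ⬝ᵥ ψ = 1) : normSq ψ = 1 := by
  have h := star_dotProduct_self_eq_normSq ψ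
  rw [h1] at h
  exact_mod_cast h.symm

/-- **The repulsive floor is at most the free floor plus `U·N/2`**: for `U ≥ 0` and `2n ≤ 2LM`,
`E_{L,M}(U; 0, 2n) ≤ E_{L,M}(0; 0, 2n) + U·n` (price a normalised FREE sector ground state in `H₀(U)`:
its interaction energy is `U·⟨Σ n↑n↓⟩ ≤ U·N↓ = U·n`, `re_expect_doublon_le`). [folklore] -/
theorem tubeEnergy_zero_le_free_add (U : ℝ) (hU : 0 ≤ U) {n : ℕ} (hn : n ≤ L * M) :
    tubeEnergy L M Λ e U 0 (2 * n) ≤ tubeEnergy L M Λ e 0 0 (2 * n) + U * n := by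
  obtain ⟨φ, h1, hgs⟩ := exists_unit_isGroundStateInSector_tubeH0 L M Λ e 0 hn
  have hφ := hgs.1
  -- price `φ` in `H₀(U)`
  have hle : tubeEnergy L M Λ e U 0 (2 * n) ≤ (expect (tubeH0 L M Λ e U) φ).re := by
    rw [tubeEnergy_zero]
    exact minEnergyOn_le_rayleigh_of_mem (isHermitian_tubeH0 L M Λ e U) _ hφ h1
  -- its free energy is the free floor
  have hfree : (expect (tubeH0 L M Λ e 0) φ).re = tubeEnergy L M Λ e 0 0 (2 * n) := by
    rw [expect, hgs.2.2, dotProduct_smul, h1, smul_eq_mul, mul_one, Complex.ofReal_re, tubeEnergy_zero]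
  -- its interaction energy is at most `U n`
  have hsec : IsInSector n n φ := by
    rw [← mem_szSector_iff_isInSector, ← szSector_two_mul_zero_eq]
    exact hφ
  have hD := re_expect_doublon_le Λ hsec
  rw [normSq_eq_one_of_unit Λ h1, mul_one] at hD
  have hsplit : (expect (tubeH0 L M Λ e U) φ).re =
      (expect (tubeH0 L M Λ e 0) φ).re + U * (expect (∑ x : Λ, numberOp x 0 * numberOp x 1) φ).re := by
    rw [tubeH0_eq_zero_add_smul L M Λ e U, expect_add, expect_smul, Complex.add_re, Complex.re_ofReal_mul]
  rw [hsplit, hfree] at hle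
  nlinarith [mul_le_mul_of_nonneg_left hD hU]

/-- **KINETIC FLOOR ON THE WINDOW, REDUCED TO FREE FERMI SUMS** (`L, M ≥ 3`, `U ≥ 0`). For every
unit vector `ψ` of the sector `(2n, S^z = 0)` of the untwisted tube lying in the energy window
`Re⟨ψ, H₀(U)ψ⟩ - E_{L,M}(U; 0, 2n) ≤ wM/L`, the longitudinal kinetic form obeys
`K(ψ) ≥ 2Σ_{k∈F_⊥} ε_⊥(k) - E_{L,M}(0; 0, 2n) - U·n - wM/L`, where `F_⊥` is any Fermi set of `n`
momenta of the transverse band `ε_⊥(a,b) = -2cos(2πb/M)` and `E_{L,M}(0; 0, 2n)` is the FREE sector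
floor (`= 2Σ_F ε_{L,M}` over a Fermi set of the full band, `tubeEnergy_free_eq`): hopping split
`Re⟨H₀(U)⟩ = -K + Re⟨T_⊥⟩ + U⟨D⟩`, transverse bathtub `Re⟨T_⊥⟩ ≥ 2Σ_{F_⊥} ε_⊥`, `⟨D⟩ ≥ 0`, and
`E(U;0,2n) ≤ E(0;0,2n) + U n`. The hypothesis `KineticFloorAt` of idea card `landau-window-yrast`
(crux stmt-16312) thus holds with the explicit per-size constant
`k'·LM = 2Σ_{F_⊥} ε_⊥ - E_free(2n) - U n - wM/L` (Pauli principle alone; `≈ 0.31·LM` at `δ = 0.2`,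
small `U`). [cite: ScalapinoWhiteZhang1993, §II] -/
theorem longKinetic_ge_of_window (hL : 3 ≤ L) (hM : 3 ≤ M) (U : ℝ) (hU : 0 ≤ U)
    (F : Finset (ZMod L × ZMod M)) (μ : ℝ)
    (hF : ∀ k ∈ F, -2 * Real.cos (2 * Real.pi * (k.2.val : ℝ) / M) ≤ μ)
    (hF' : ∀ k ∉ F, μ ≤ -2 * Real.cos (2 * Real.pi * (k.2.val : ℝ) / M)) (hn : F.card ≤ L * M)
    {ψ : Fock (Orb Λ)} (hψ : ψ ∈ szSector (2 * F.card) 0) (h1 : star ψ ⬝ᵥ ψ = 1) (w : ℝ)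
    (hwin : (expect (tubeH0 L M Λ e U) ψ).re - tubeEnergy L M Λ e U 0 (2 * F.card) ≤ w * M / L) :
    2 * (∑ k ∈ F, -2 * Real.cos (2 * Real.pi * (k.2.val : ℝ) / M)) - tubeEnergy L M Λ e 0 0 (2 * F.card) -
        U * F.card - w * M / L ≤ (∑ a : ZMod L, ∑ b : ZMod M, ∑ σ : Fin 2,
          (expect (creation (orb (e.symm (a, b)) σ) * annihilation (orb (e.symm (a - 1, b)) σ) +
            creation (orb (e.symm (a - 1, b)) σ) * annihilation (orb (e.symm (a, b)) σ)) ψ).re) := by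
  have hsplit := re_expect_tubeH0_eq_neg_longKinetic_add L M Λ e hL (by omega) U ψ
  have hT := transFermiSum_mul_normSq_le L M Λ e hM F μ hF hF' hψ
  rw [normSq_eq_one_of_unit Λ h1, mul_one] at hT
  have hD0 : 0 ≤ U * (expect (∑ x : Λ, numberOp x 0 * numberOp x 1) ψ).re :=
    mul_nonneg hU (HubbardBandBottom.re_rayleigh_doublon_nonneg ψ)
  have hE := tubeEnergy_zero_le_free_add L M Λ e U hU hn
  linarith

/-- **The same with the free floor written out** (`tubeEnergy_free_eq`): for Fermi sets `F_⊥` of the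
transverse band and `F` of the full band `ε_{L,M} = tubeBand` with the same number `n` of momenta,
every unit window vector `ψ` of the sector `(2n, 0)` has
`K(ψ) ≥ 2(Σ_{F_⊥} ε_⊥ - Σ_F ε_{L,M}) - U·n - wM/L` — the kinetic floor of the card in closed form, a
free-fermion number minus `U n + wM/L`. [cite: ScalapinoWhiteZhang1993, §II] -/
theorem longKinetic_ge_of_window_free (hL : 3 ≤ L) (hM : 3 ≤ M) (U : ℝ) (hU : 0 ≤ U)
    (Ft F : Finset (ZMod L × ZMod M)) (μt μ : ℝ)
    (hFt : ∀ k ∈ Ft, -2 * Real.cos (2 * Real.pi * (k.2.val : ℝ) / M) ≤ μt)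
    (hFt' : ∀ k ∉ Ft, μt ≤ -2 * Real.cos (2 * Real.pi * (k.2.val : ℝ) / M))
    (hF : ∀ k ∈ F, tubeBand L M k ≤ μ) (hF' : ∀ k ∉ F, μ ≤ tubeBand L M k)
    (hcard : F.card = Ft.card) (hn : Ft.card ≤ L * M)
    {ψ : Fock (Orb Λ)} (hψ : ψ ∈ szSector (2 * Ft.card) 0) (h1 : star ψ ⬝ᵥ ψ = 1) (w : ℝ)
    (hwin : (expect (tubeH0 L M Λ e U) ψ).re - tubeEnergy L M Λ e U 0 (2 * Ft.card) ≤ w * M / L) :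
    2 * ((∑ k ∈ Ft, -2 * Real.cos (2 * Real.pi * (k.2.val : ℝ) / M)) - ∑ k ∈ F, tubeBand L M k) -
        U * Ft.card - w * M / L ≤ (∑ a : ZMod L, ∑ b : ZMod M, ∑ σ : Fin 2,
          (expect (creation (orb (e.symm (a, b)) σ) * annihilation (orb (e.symm (a - 1, b)) σ) +
            creation (orb (e.symm (a - 1, b)) σ) * annihilation (orb (e.symm (a, b)) σ)) ψ).re) := by
  have h := longKinetic_ge_of_window L M Λ e hL hM U hU Ft μt hFt hFt' hn hψ h1 w hwin
  rw [← hcard, tubeEnergy_free_eq e hL hM F μ hF hF', hcard] at h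
  linarith

/-- **`KineticFloorAt` at the cruxes' filling, in the hypothesis shape of the Landau reductions**
(`tubeStiffness_ge_of_landauCriterion` / `tubeStiffness_ge_of_landauWindow`): for `L, M ≥ 3`,
`U ≥ 0`, `δ ≥ -1`, Fermi sets `F_⊥` (transverse band) and `F` (full band) of `N_{L,M}(δ)/2` momenta
each, and any `k'` with `k'·LM ≤ 2(Σ_{F_⊥} ε_⊥ - Σ_F ε_{L,M}) - U·N_{L,M}(δ)/2 - wM/L`, every unit vector
of the sector `(N_{L,M}(δ), 0)` in the window `Re⟨ψ,H₀ψ⟩ - E(0) ≤ wM/L` has `k'·LM ≤ K(ψ)`.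
[cite: ScalapinoWhiteZhang1993, §II] -/
theorem kineticFloor_window_of_freeSums (hL : 3 ≤ L) (hM : 3 ≤ M) (U : ℝ) (hU : 0 ≤ U) {δ : ℝ}
    (hδ : -1 ≤ δ) (Ft F : Finset (ZMod L × ZMod M)) (μt μ : ℝ)
    (hFt : ∀ k ∈ Ft, -2 * Real.cos (2 * Real.pi * (k.2.val : ℝ) / M) ≤ μt)
    (hFt' : ∀ k ∉ Ft, μt ≤ -2 * Real.cos (2 * Real.pi * (k.2.val : ℝ) / M))
    (hF : ∀ k ∈ F, tubeBand L M k ≤ μ) (hF' : ∀ k ∉ F, μ ≤ tubeBand L M k)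
    (hcardt : Ft.card = ⌊(1 - δ) * ((L : ℝ) * (M : ℝ)) / 2⌋₊) (hcard : F.card = ⌊(1 - δ) * ((L : ℝ) * (M : ℝ)) / 2⌋₊)
    (w k' : ℝ)
    (hk' : k' * ((L : ℝ) * M) ≤ 2 * ((∑ k ∈ Ft, -2 * Real.cos (2 * Real.pi * (k.2.val : ℝ) / M)) -
      ∑ k ∈ F, tubeBand L M k) - U * ⌊(1 - δ) * ((L : ℝ) * (M : ℝ)) / 2⌋₊ - w * M / L) :
    ∀ ψ ∈ szSector (Λ := Λ) (tubeFilling L M δ) 0, star ψ ⬝ᵥ ψ = (1 : ℂ) →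
      (expect (tubeH0 L M Λ e U) ψ).re - tubeEnergy L M Λ e U 0 (tubeFilling L M δ) ≤ w * M / L →
        k' * ((L : ℝ) * M) ≤ (∑ a : ZMod L, ∑ b : ZMod M, ∑ σ : Fin 2,
          (expect (creation (orb (e.symm (a, b)) σ) * annihilation (orb (e.symm (a - 1, b)) σ) +
            creation (orb (e.symm (a - 1, b)) σ) * annihilation (orb (e.symm (a, b)) σ)) ψ).re) := by
  intro ψ hψ h1 hwin
  have hn : Ft.card ≤ L * M := by rw [hcardt]; exact half_tubeFilling_le L M hδ
  have hfill : tubeFilling L M δ = 2 * Ft.card := by rw [tubeFilling, hcardt]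
  rw [hfill] at hψ hwin
  have h := longKinetic_ge_of_window_free L M Λ e hL hM U hU Ft F μt μ hFt hFt' hF hF' (hcard.trans hcardt.symm)
    hn hψ h1 w hwin
  rw [hcardt] at h
  linarith

end KineticWindow
end Summit.HubbardSuperconductivity.HubbardSuperconductivity.Theorems.WidthHaldane

end
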